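import Mathlib.CategoryTheory.NatIso
import Literature.AlgebraicGeometry.Frobenioids.FSMIMorphisms
import HarnessLib

/-!
# Frobenioids I, §0: FSM endomorphisms and natural endomorphisms in categories of FSMFF-type

S. Mochizuki, *The geometry of Frobenioids I: the general theory*, Kyushu J. Math. **62** (2008), §0
"Categories", kurims pp. 14–18: FSM-morphisms (p. 14), FSMI-morphisms and categories of FSMFF-type
(pp. 17–18), totally epimorphic categories (p. 15). Print (p. 18): "We observe that [by condition (b)] no
endomorphism of an object of a category of FSMFF-type is an FSMI-morphism" — the tree's
`IsOfFSMFFType.not_isFSMI_of_endomorphism` [cite: MochizukiFrdI2008, §0 p.18].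

PROOF-ONLY file (abc-iut cell, seat abc-iut-w5-d105), no definition introduced, no statement of the paper
strengthened or re-typed. It records three formal consequences of conditions (a), (b) of "FSMFF-type"
that the cell uses when checking base categories `D` against the hypothesis "`D` of FSMFF-type" ([EtTh]
Cor. 3.8, `Cor38Hyp.fsmff`; [FrdI] Thm. 3.4 (ii)):

* `IsFSMIChain.comp_chain`, `IsFSMIChain.exists_longChain_of_endo` — FSMI-chains concatenate; an
  endomorphism that is an FSMI-chain has FSMI-chain powers of unbounded length;
* `IsOfFSMFFType.isIso_of_isFSM_of_isEndomorphism` — in a category of FSMFF-type **every FSM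
  ENDOmorphism is an isomorphism** (by (a) a non-invertible one is an FSMI-chain of length `n ≥ 1`, so its
  powers are chains of unbounded length out of one object, against (b)); this is the general form of the
  printed observation and of the tree's one-object case `IsOfFSMFFType.isIso_of_isFSM_of_subsingleton`;
* `IsOfFSMFFType.isIso_of_natural_family` / `…isIso_app_natTrans_id_of_isTotallyEpimorphic` /
  `…isIso_natTrans_id_of_isTotallyEpimorphic` — in a **totally epimorphic** category of FSMFF-type every
  family of endomorphisms `g_X : X → X` natural in `X` (in particular every natural endomorphism
  `η : 𝟭 ⟶ 𝟭` of the identity functor) consists of ISOmorphisms: each member is fiberwise-surjective (the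
  naturality squares are the required squares) and a monomorphism (naturality moves the cancellation to
  the epimorphism `g_Z`), hence FSM, hence invertible by the previous item.

Cell use (bookkeeping, F-2815 census): the last item is the obstruction that prevents a "contracting base
loop" from impersonating a Frobenius endomorphism under an equivalence of model Frobenioids — a family of
base loops natural along all of `D` consists of automorphisms. Nothing here is specific to Frobenioids.
-/

namespace Literature.AlgebraicGeometry.Frobenioids

open CategoryTheory

universe v u

variable {C : Type u} [Category.{v} C]

/-! ### FSMI-chains: concatenation and powers -/

/-- FSMI-chains concatenate: a composite of a chain of length `n` and a chain of length `m` is a chain of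
length `m + n` (the bookkeeping behind "composites of finitely many FSMI-morphisms", §0 p. 17).
[cite: MochizukiFrdI2008, §0 p.17] -/
theorem IsFSMIChain.comp_chain {A B B' : C} {φ : A ⟶ B} {n : ℕ} (h : IsFSMIChain φ n) {ψ : B ⟶ B'}
    {m : ℕ} (h' : IsFSMIChain ψ m) : IsFSMIChain (φ ≫ ψ) (m + n) := by
  induction h with
  | single φ hφ => exact IsFSMIChain.cons φ ψ m hφ h'
  | cons χ₁ χ k hχ₁ _ ih =>
    rw [Category.assoc]
    exact IsFSMIChain.cons χ₁ (χ ≫ ψ) (m + k) hχ₁ (ih h')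

/-- An endomorphism that is an FSMI-chain has composites with itself that are FSMI-chains of length at
least any prescribed `k` (all starting at the same object). [cite: MochizukiFrdI2008, §0 p.18] -/
theorem IsFSMIChain.exists_longChain_of_endo {A : C} {φ : A ⟶ A} {n : ℕ} (h : IsFSMIChain φ n)
    (k : ℕ) : ∃ (ψ : A ⟶ A) (m : ℕ), k ≤ m ∧ IsFSMIChain ψ m := by
  induction k with
  | zero => exact ⟨φ, n, Nat.zero_le n, h⟩
  | succ k ih =>
    obtain ⟨ψ, m, hkm, hψ⟩ := ih
    refine ⟨φ ≫ ψ, m + n, ?_, h.comp_chain hψ⟩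
    have hn : 0 < n := h.pos
    omega

/-! ### FSM endomorphisms in categories of FSMFF-type -/

/-- **In a category of FSMFF-type every FSM endomorphism is an isomorphism** (general form of "no
endomorphism of an object of a category of FSMFF-type is an FSMI-morphism", §0 p. 18): otherwise, by
condition (a), it is an FSMI-chain of positive length, and its composites with itself are FSMI-chains of
unbounded length out of one object, contradicting condition (b). [cite: MochizukiFrdI2008, §0 p.18] -/
theorem IsOfFSMFFType.isIso_of_isFSM_of_isEndomorphism (hC : IsOfFSMFFType C) {A : C} (φ : A ⟶ A)
    (hφ : IsFSM φ) : IsIso φ := by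
  by_contra hi
  obtain ⟨n, hn⟩ := hC.factors φ hφ hi
  obtain ⟨N, hN⟩ := hC.bounded A
  obtain ⟨ψ, m, hm, hψ⟩ := hn.exists_longChain_of_endo (N + 1)
  have := hN ψ m hψ
  omega

/-- In a category of FSMFF-type the FSM endomorphisms of an object are exactly its automorphisms
(isomorphisms being FSM-morphisms, `IsFSM.of_isIso`). [cite: MochizukiFrdI2008, §0 p.18] -/
theorem IsOfFSMFFType.isFSM_iff_isIso_of_isEndomorphism (hC : IsOfFSMFFType C) {A : C} (φ : A ⟶ A) :
    IsFSM φ ↔ IsIso φ :=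
  ⟨hC.isIso_of_isFSM_of_isEndomorphism φ, fun _ => IsFSM.of_isIso φ⟩

/-! ### Natural families of endomorphisms and natural endomorphisms of the identity functor -/

section NaturalFamilies

variable (g : ∀ X : C, X ⟶ X) (hg : ∀ ⦃X Y : C⦄ (f : X ⟶ Y), f ≫ g Y = g X ≫ f)
include hg

/-- The members of a family of endomorphisms `g_X : X → X` natural in `X` (`f ≫ g_Y = g_X ≫ f`) are
fiberwise-surjective: for `γ : Z → X` the naturality square at `γ` is the required square (§0 p. 14).
[cite: MochizukiFrdI2008, §0 p.14] -/
theorem isFiberwiseSurjective_of_natural_family (X : C) : IsFiberwiseSurjective (g X) :=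
  fun Z γ => ⟨Z, γ, g Z, hg γ⟩

/-- In a totally epimorphic category the members of a natural family of endomorphisms are monomorphisms:
`u ≫ g_X = v ≫ g_X` gives, by naturality, `g_Z ≫ u = g_Z ≫ v`, and `g_Z` is an epimorphism (§0 p. 15).
[cite: MochizukiFrdI2008, §0 p.15] -/
theorem mono_of_natural_family_of_isTotallyEpimorphic (hE : IsTotallyEpimorphic C) (X : C) :
    Mono (g X) := by
  refine ⟨fun {Z} u v huv => ?_⟩
  haveI := hE.epi (g Z)
  refine (cancel_epi (g Z)).1 ?_
  rw [← hg u, ← hg v]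
  exact huv

/-- In a totally epimorphic category the members of a natural family of endomorphisms are FSM-morphisms.
[cite: MochizukiFrdI2008, §0 p.15] -/
theorem isFSM_of_natural_family_of_isTotallyEpimorphic (hE : IsTotallyEpimorphic C) (X : C) :
    IsFSM (g X) :=
  ⟨isFiberwiseSurjective_of_natural_family g hg X,
    mono_of_natural_family_of_isTotallyEpimorphic g hg hE X⟩

/-- **In a totally epimorphic category of FSMFF-type, a family of endomorphisms `g_X : X → X` natural in
`X` consists of automorphisms**: each member is an FSM endomorphism (previous lemma), hence an isomorphism
(`IsOfFSMFFType.isIso_of_isFSM_of_isEndomorphism`). Formal consequence of §0 pp. 15, 18, not stated in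
print. [cite: MochizukiFrdI2008, §0 p.18] -/
theorem IsOfFSMFFType.isIso_of_natural_family (hC : IsOfFSMFFType C) (hE : IsTotallyEpimorphic C)
    (X : C) : IsIso (g X) :=
  hC.isIso_of_isFSM_of_isEndomorphism _ (isFSM_of_natural_family_of_isTotallyEpimorphic g hg hE X)

end NaturalFamilies

/-- In a totally epimorphic category of FSMFF-type every natural endomorphism `η : 𝟭_C ⟶ 𝟭_C` of the
identity functor has invertible components. [cite: MochizukiFrdI2008, §0 p.18] -/
theorem IsOfFSMFFType.isIso_app_natTrans_id_of_isTotallyEpimorphic (hC : IsOfFSMFFType C)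
    (hE : IsTotallyEpimorphic C) (η : 𝟭 C ⟶ 𝟭 C) (X : C) : IsIso (η.app X) := by
  have hg : ∀ ⦃X Y : C⦄ (f : X ⟶ Y), f ≫ η.app Y = η.app X ≫ f := fun X Y f => by
    simpa only [Functor.id_obj, Functor.id_map] using η.naturality f
  exact hC.isIso_of_natural_family (fun X => η.app X) hg hE X

/-- In a totally epimorphic category of FSMFF-type every natural endomorphism `η : 𝟭_C ⟶ 𝟭_C` is a
natural isomorphism (the endomorphism monoid of `𝟭_C` is a group). [cite: MochizukiFrdI2008, §0 p.18] -/
theorem IsOfFSMFFType.isIso_natTrans_id_of_isTotallyEpimorphic (hC : IsOfFSMFFType C)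
    (hE : IsTotallyEpimorphic C) (η : 𝟭 C ⟶ 𝟭 C) : IsIso η := by
  haveI : ∀ X : C, IsIso (η.app X) := fun X => hC.isIso_app_natTrans_id_of_isTotallyEpimorphic hE η X
  exact NatIso.isIso_of_isIso_app η

end Literature.AlgebraicGeometry.Frobenioids
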